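import Summits.QuantumFields.YangMills.Theorems.EquipartitionCriticalityFreeEnergyLogCoefficientExpLipschitz
import HarnessLib

/-!
# Stub `stub_expCommutatorBracket` for line `Sketch` of crux `FemtoCurvatureTwoPointC`

Group commutators of exponentials of small skew-Hermitian matrices versus Lie brackets, in the
Frobenius norm on `M_N(ℂ)`. For skew-Hermitian `a, b` put `U = e^a`, `V = e^b` (unitary) and
`c = U b U⁻¹ = e^a b e^{-a}` (skew-Hermitian, `‖c‖ = ‖b‖`). Then
`U V U⁻¹ V⁻¹ − 1 = (e^{c} − e^{b}) e^{-b}`, so `‖U V U⁻¹ V⁻¹ − 1‖ = ‖e^c − e^b‖` (unitary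
invariance of the Frobenius norm), and the two-sided Lipschitz bounds for `exp` on `𝔲(N)`
(`norm_exp_sub_exp_le_of_skew`, `sub_mul_norm_sub_le_norm_exp_sub_exp`, file
`…FreeEnergyLogCoefficientExpLipschitz`) reduce everything to `δ := c − b = Ad(e^a) b − b`:
* `‖δ‖ ≤ ‖ab − ba‖` (`norm_conj_sub_le`): the path `t ↦ e^{ta} b e^{-ta}` has derivative
  `e^{ta} (ab − ba) e^{-ta}`, of Frobenius norm exactly `‖ab − ba‖`; mean value inequality.
* `‖δ − (ab − ba)‖ ≤ 2‖a‖ ‖ab − ba‖` (`norm_conj_sub_sub_bracket_le`): the same for the path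
  `t ↦ e^{ta} b e^{-ta} − t (ab − ba)`, whose derivative `Ad(e^{ta})(ab − ba) − (ab − ba)` is bounded
  by the first bullet applied to `ta` and `ab − ba`.
Hence the UPPER bound `‖U V U⁻¹ V⁻¹ − 1‖ ≤ ‖ab − ba‖` (no smallness), and for `‖a‖, ‖b‖ ≤ 1/4` the
LOWER bound `‖U V U⁻¹ V⁻¹ − 1‖ ≥ (2 − e^{1/4}) ‖δ‖ ≥ (2 − e^{1/4}) ‖ab − ba‖ / 2 ≥ ‖ab − ba‖ / 4`
(`e^{1/4} ≤ 4/3`). Standard Lie-theory estimates; no single source.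
-/

set_option autoImplicit false

noncomputable section

open scoped Matrix Matrix.Norms.Frobenius
open NormedSpace Set
open Summit.QuantumFields.YangMills.Theorems.FreeEnergyLogCoefficient

namespace Summit.QuantumFields.YangMills.Theorems.FemtoCurvatureTwoPointC

/-! ### Conjugation by exponentials of skew-Hermitian matrices (helpers) -/

namespace ExpCommutatorBracket

variable {N : ℕ}

/-- The negative of a skew-Hermitian matrix is skew-Hermitian. [folklore] -/
theorem conjTranspose_neg_of_skew {a : Matrix (Fin N) (Fin N) ℂ} (ha : aᴴ = -a) : (-a)ᴴ = -(-a) := by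
  rw [Matrix.conjTranspose_neg, ha]

/-- `e^{a} e^{-a} = 1`. [folklore] -/
theorem exp_mul_exp_neg (a : Matrix (Fin N) (Fin N) ℂ) : exp a * exp (-a) = 1 := by
  rw [← Matrix.exp_add_of_commute a (-a) (Commute.refl a).neg_right, add_neg_cancel, exp_zero]

/-- `e^{-a} e^{a} = 1`. [folklore] -/
theorem exp_neg_mul_exp (a : Matrix (Fin N) (Fin N) ℂ) : exp (-a) * exp a = 1 := by
  rw [← Matrix.exp_add_of_commute (-a) a (Commute.refl a).neg_left, neg_add_cancel, exp_zero]

/-- Unitary conjugation invariance of the Frobenius norm: `‖e^{a} x e^{-a}‖ = ‖x‖` for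
skew-Hermitian `a`. [folklore] -/
theorem norm_exp_mul_mul_exp_neg {a : Matrix (Fin N) (Fin N) ℂ} (ha : aᴴ = -a)
    (x : Matrix (Fin N) (Fin N) ℂ) : ‖exp a * x * exp (-a)‖ = ‖x‖ := by
  have h1 : ‖exp a * (x * exp (-a))‖ = ‖x * exp (-a)‖ :=
    Matrix.frobenius_norm_unitaryGroup_mul ⟨exp a, exp_mem_unitaryGroup_of_skew ha⟩ _
  have h2 : ‖x * exp (-a)‖ = ‖x‖ :=
    Matrix.frobenius_norm_mul_unitaryGroup x
      ⟨exp (-a), exp_mem_unitaryGroup_of_skew (conjTranspose_neg_of_skew ha)⟩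
  rw [Matrix.mul_assoc, h1, h2]

/-- Conjugation by the unit `e^{a}` commutes with the exponential:
`e^{a} e^{x} e^{-a} = exp (e^{a} x e^{-a})`. [folklore] -/
theorem exp_mul_exp_mul_exp_neg (a x : Matrix (Fin N) (Fin N) ℂ) :
    exp a * exp x * exp (-a) = exp (exp a * x * exp (-a)) := by
  set u : (Matrix (Fin N) (Fin N) ℂ)ˣ := ⟨exp a, exp (-a), exp_mul_exp_neg a, exp_neg_mul_exp a⟩
  exact (exp_units_conj u x).symm

/-- The conjugation path `t ↦ e^{ta} x e^{-ta}` has derivative `e^{ta} (a x − x a) e^{-ta}`. [folklore] -/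
theorem hasDerivAt_conjPath (a x : Matrix (Fin N) (Fin N) ℂ) (t : ℝ) :
    HasDerivAt (fun s : ℝ => exp (s • a) * x * exp (s • (-a)))
      (exp (t • a) * (a * x - x * a) * exp (t • (-a))) t := by
  have h1 : HasDerivAt (fun s : ℝ => exp (s • a)) (exp (t • a) * a) t :=
    hasDerivAt_exp_smul_const a t
  have h2 : HasDerivAt (fun s : ℝ => exp (s • (-a))) (exp (t • (-a)) * (-a)) t :=
    hasDerivAt_exp_smul_const (-a) t
  have h3 := (h1.mul_const x).fun_mul h2
  refine h3.congr_deriv ?_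
  have hc : exp (t • (-a)) * a = a * exp (t • (-a)) :=
    (((Commute.refl a).neg_right.smul_right t).exp_right).eq.symm
  calc exp (t • a) * a * x * exp (t • (-a)) + exp (t • a) * x * (exp (t • (-a)) * (-a))
      = exp (t • a) * a * x * exp (t • (-a)) - exp (t • a) * x * (a * exp (t • (-a))) := by
        rw [mul_neg, mul_neg, ← sub_eq_add_neg, hc]
    _ = exp (t • a) * (a * x - x * a) * exp (t • (-a)) := by noncomm_ring

/-- **`Ad` versus `ad`.** For skew-Hermitian `a` and any `x`:
`‖e^{a} x e^{-a} − x‖ ≤ ‖a x − x a‖` (mean value inequality along `t ↦ e^{ta} x e^{-ta}`, whose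
derivative `e^{ta}(ax − xa)e^{-ta}` has Frobenius norm `‖ax − xa‖`). [folklore] -/
theorem norm_conj_sub_le {a : Matrix (Fin N) (Fin N) ℂ} (ha : aᴴ = -a) (x : Matrix (Fin N) (Fin N) ℂ) :
    ‖exp a * x * exp (-a) - x‖ ≤ ‖a * x - x * a‖ := by
  have key := norm_image_sub_le_of_norm_deriv_le_segment_01'
    (f := fun s : ℝ => exp (s • a) * x * exp (s • (-a)))
    (f' := fun s : ℝ => exp (s • a) * (a * x - x * a) * exp (s • (-a)))
    (C := ‖a * x - x * a‖)
    (fun s _ => (hasDerivAt_conjPath a x s).hasDerivWithinAt)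
    (fun s _ => by
      have hs : (s • a)ᴴ = -(s • a) := conjTranspose_smul_of_skew ha s
      have h := norm_exp_mul_mul_exp_neg hs (a * x - x * a)
      rw [← smul_neg] at h
      exact h.le)
  simpa using key

/-- **Second-order `Ad` versus `ad`.** For skew-Hermitian `a` and any `x`:
`‖(e^{a} x e^{-a} − x) − (ax − xa)‖ ≤ 2‖a‖ ‖ax − xa‖` (mean value inequality along
`t ↦ e^{ta} x e^{-ta} − t(ax − xa)`, whose derivative `Ad(e^{ta})(ax − xa) − (ax − xa)` is bounded by
`norm_conj_sub_le` for `ta`: `‖(ta)(ax − xa) − (ax − xa)(ta)‖ ≤ 2‖a‖‖ax − xa‖` on `[0,1]`). [folklore] -/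
theorem norm_conj_sub_sub_bracket_le {a : Matrix (Fin N) (Fin N) ℂ} (ha : aᴴ = -a)
    (x : Matrix (Fin N) (Fin N) ℂ) :
    ‖(exp a * x * exp (-a) - x) - (a * x - x * a)‖ ≤ 2 * ‖a‖ * ‖a * x - x * a‖ := by
  set X := a * x - x * a
  have hder : ∀ s : ℝ, HasDerivAt (fun s : ℝ => exp (s • a) * x * exp (s • (-a)) - s • X)
      (exp (s • a) * X * exp (s • (-a)) - X) s := by
    intro s
    have h := (hasDerivAt_conjPath a x s).fun_sub ((hasDerivAt_id' s).smul_const X)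
    refine h.congr_deriv ?_
    rw [one_smul]
  have key := norm_image_sub_le_of_norm_deriv_le_segment_01'
    (f := fun s : ℝ => exp (s • a) * x * exp (s • (-a)) - s • X)
    (f' := fun s : ℝ => exp (s • a) * X * exp (s • (-a)) - X)
    (C := 2 * ‖a‖ * ‖X‖)
    (fun s _ => (hder s).hasDerivWithinAt)
    (fun s hs => by
      have hsa : (s • a)ᴴ = -(s • a) := conjTranspose_smul_of_skew ha s
      have h1 := norm_conj_sub_le hsa X
      rw [← smul_neg] at h1
      have hs1 : |s| ≤ 1 := abs_le.2 ⟨by linarith [hs.1], hs.2.le⟩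
      have h2 : ‖s • a * X - X * (s • a)‖ ≤ 2 * ‖a‖ * ‖X‖ := by
        calc ‖s • a * X - X * (s • a)‖ ≤ ‖s • a * X‖ + ‖X * (s • a)‖ := norm_sub_le _ _
          _ ≤ ‖s • a‖ * ‖X‖ + ‖X‖ * ‖s • a‖ := add_le_add (norm_mul_le _ _) (norm_mul_le _ _)
          _ = 2 * (|s| * ‖a‖) * ‖X‖ := by rw [norm_smul, Real.norm_eq_abs]; ring
          _ ≤ 2 * (1 * ‖a‖) * ‖X‖ := by gcongr
          _ = 2 * ‖a‖ * ‖X‖ := by ring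
      exact h1.trans h2)
  have e : (exp a * x * exp (-a) - x) - X =
      (exp ((1 : ℝ) • a) * x * exp ((1 : ℝ) • (-a)) - (1 : ℝ) • X) -
        (exp ((0 : ℝ) • a) * x * exp ((0 : ℝ) • (-a)) - (0 : ℝ) • X) := by
    simp only [one_smul, zero_smul, exp_zero, one_mul, mul_one, sub_zero]
    abel
  rw [e]
  exact key

end ExpCommutatorBracket

open ExpCommutatorBracket in
/-- **Group commutators of exponentials versus Lie brackets (stub `stub_expCommutatorBracket`).**
For skew-Hermitian `a, b ∈ M_N(ℂ)` (Frobenius norm):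
`‖e^a e^b e^{-a} e^{-b} − 1‖ ≤ ‖ab − ba‖`, and if `‖a‖, ‖b‖ ≤ 1/4` then
`‖ab − ba‖ / 4 ≤ ‖e^a e^b e^{-a} e^{-b} − 1‖`. Proof: with `c = e^a b e^{-a}`,
`e^a e^b e^{-a} e^{-b} − 1 = (e^c − e^b) e^{-b}` and `‖c − b‖ ≤ ‖ab − ba‖`,
`‖(c − b) − (ab − ba)‖ ≤ 2‖a‖‖ab − ba‖`; then the two-sided Lipschitz bounds for `exp` on `𝔲(N)`.
[folklore] -/
theorem stub_expCommutatorBracket :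
    ∀ (N : ℕ) (a b : Matrix (Fin N) (Fin N) ℂ), aᴴ = -a → bᴴ = -b →
      ‖NormedSpace.exp a * NormedSpace.exp b * NormedSpace.exp (-a) * NormedSpace.exp (-b) - 1‖ ≤ ‖a * b - b * a‖ ∧
      (‖a‖ ≤ 1 / 4 → ‖b‖ ≤ 1 / 4 →
        1 / 4 * ‖a * b - b * a‖ ≤
          ‖NormedSpace.exp a * NormedSpace.exp b * NormedSpace.exp (-a) * NormedSpace.exp (-b) - 1‖) := by
  intro N a b ha hb
  set c := exp a * b * exp (-a) with hc
  have hcskew : cᴴ = -c := by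
    rw [hc, Matrix.conjTranspose_mul, Matrix.conjTranspose_mul, ← Matrix.exp_conjTranspose,
      ← Matrix.exp_conjTranspose, hb, Matrix.conjTranspose_neg, ha, neg_neg, ← Matrix.mul_assoc,
      mul_neg, neg_mul]
  have hid : exp a * exp b * exp (-a) * exp (-b) - 1 = (exp c - exp b) * exp (-b) := by
    rw [sub_mul, exp_mul_exp_neg b, hc, ← exp_mul_exp_mul_exp_neg a b]
  have hnorm : ‖exp a * exp b * exp (-a) * exp (-b) - 1‖ = ‖exp c - exp b‖ := by
    rw [hid]
    exact Matrix.frobenius_norm_mul_unitaryGroup _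
      ⟨exp (-b), exp_mem_unitaryGroup_of_skew (conjTranspose_neg_of_skew hb)⟩
  have hδ : ‖c - b‖ ≤ ‖a * b - b * a‖ := norm_conj_sub_le ha b
  refine ⟨?_, ?_⟩
  · rw [hnorm]
    exact (norm_exp_sub_exp_le_of_skew hcskew hb).trans hδ
  · intro ha4 hb4
    rw [hnorm]
    have hcn : ‖c‖ ≤ 1 / 4 := by rw [hc, norm_exp_mul_mul_exp_neg ha]; exact hb4
    have hlow := sub_mul_norm_sub_le_norm_exp_sub_exp hcn hb4
    have hB := norm_conj_sub_sub_bracket_le ha b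
    have hX_le : ‖a * b - b * a‖ ≤ ‖c - b‖ + ‖(c - b) - (a * b - b * a)‖ := by
      have h := norm_sub_le (c - b) ((c - b) - (a * b - b * a))
      rwa [sub_sub_cancel] at h
    have hexp : Real.exp (1 / 4) ≤ 4 / 3 := by
      have h := Real.exp_bound_div_one_sub_of_interval (x := 1 / 4) (by norm_num) (by norm_num)
      norm_num at h
      exact h
    have h1 : ‖(c - b) - (a * b - b * a)‖ ≤ 1 / 2 * ‖a * b - b * a‖ := by
      calc ‖(c - b) - (a * b - b * a)‖ ≤ 2 * ‖a‖ * ‖a * b - b * a‖ := hB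
        _ ≤ 2 * (1 / 4) * ‖a * b - b * a‖ := by gcongr
        _ = 1 / 2 * ‖a * b - b * a‖ := by ring
    have h2 : ‖a * b - b * a‖ ≤ 2 * ‖c - b‖ := by linarith
    have h3 : 1 / 2 * ‖c - b‖ ≤ ‖exp c - exp b‖ := by
      have h : 1 / 2 * ‖c - b‖ ≤ (2 - Real.exp (1 / 4)) * ‖c - b‖ := by
        apply mul_le_mul_of_nonneg_right _ (norm_nonneg _)
        linarith
      exact h.trans hlow
    linarith

end Summit.QuantumFields.YangMills.Theorems.FemtoCurvatureTwoPointC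

end
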